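import Literature.MathematicalPhysics.QuantumFieldTheory.Balaban1983to89.B5Prop11Plancherel
import HarnessLib

/-!
# The abstract Plancherel FLOOR: a block-diagonal family is coercive on the kernel of a block-diagonal
# constraint as soon as every block is — the lower-bound twin of `B5Prop11Plancherel.opNorm_le_of_blocks`;
# and the SHARP aliased-mode symbol bound `|∂_μ(p′ + l)|² ≥ 4n²·sin²(π∕2n)` (`l ≠ 0`)

Width seat `ym3-torus-px16` (gen 20); `--kind proof --supports stmt-QuantumFields-20520 --as helper`, count-neutral,
DEFINITION-FREE (0 `def`, 0 `instance`, 0 `notation`, default heartbeats).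

Bears on crux stmt-QuantumFields-20520 `FluctuationComparisonRegPrIntL`, LINE `semiclassical_s2beta`, registered
stub GAP♯∘ `stub_uniformFibreGapOrbit` through the depth-uniform flat letter `hFlat` of
✓`…S2BetaGapOrbitOfStrata.uniformFibreGapOrbit_of_strata_of_flat` (UV3-NODE §53–§54): the SPECTRAL road to
`hFlat`'s linear core (px20 g18, UV3-NODE §53.10 «Bloch reduction») decomposes the constrained Poincaré floor
of `‖d₁a‖²` on `ker Q_m ⊖ {residual gauges}` over the `M³` Bloch sectors of the block translations and proves it
sector by sector.  Its GENERIC layer is (B1) «block-Fourier for block-periodic operators» + (B2) «aliased modes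
are free».  In the tree, (B1) exists for the UPPER direction — lit `B5Prop11Plancherel` §1–§4: the unitary DFT of
the finite torus, the coset bijection `blockEquiv` (`p = p′ + l` of [Balaban1984PropagatorsI] (1.31), (1.83) —
which IS the Bloch reduction in momentum space), and `opNorm_le_of_blocks` («`U T U^*` block-diagonal along some
reindexing with blocks of norm `≤ C` ⟹ `‖T‖ ≤ C`»); (B2) exists in Jordan form — lit
`B5Prop11Leaves.Sxir_shift_ge_four` ∕ `DeltaXir_shift_ge_four` (`|∂(p′+l)|² ≥ 4`, `l ≠ 0`).

What this file adds (Mathlib objects only — `Matrix.blockDiagonal` with RECTANGULAR blocks, `Matrix.mulVec`,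
`dotProduct`, `Matrix.unitaryGroup`, `Matrix.reindex`; no new definition):
* §1 `blockDiagonal_mulVec_apply`, `blockDiagonal_mulVec_eq_zero_iff`, `star_dotProduct_blockDiagonal_mulVec`
  (the quadratic form of a block-diagonal family is the sum of the blocks' forms), ★`floor_blockDiagonal_of_blocks`:
  if every block satisfies `λ·re⟨y, P_k y⟩ ≤ re⟨y, A_k y⟩` on `ker C_k`, the assembled family satisfies
  `λ·re⟨x, P x⟩ ≤ re⟨x, A x⟩` on `ker C` (`P` a second quadratic form — the pin-capacity `dist²` of §53.10 (1);
  `P := 1`-blocks give plain coercivity).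
* §2 transport under a unitary change of variables and a reindexing: `mulVec_conj_mulVec`,
  `star_mulVec_dotProduct_mulVec`, `reindex_mulVec_comp_symm`, `star_comp_dotProduct_comp`, and
  ★★`floor_of_blocks` — THE ABSTRACT PLANCHEREL FLOOR: if `U` is unitary (`U′` on the constraint's target is
  arbitrary) and `U A U^*`, `U P U^*` (reindexed along `e : m ≃ m′ × o`) and the constraint `U′ C U^*` (reindexed
  along `e′`, `e`; RECTANGULAR blocks) are block-diagonal with blocks obeying the blockwise floor on `ker C_k`, then
  `λ·re⟨x, P x⟩ ≤ re⟨x, A x⟩` for every `x ∈ ker C`; corollaries `floor_of_blocks_unconstrained` (no `C`),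
  `coercive_of_blocks_on_ker` (`P := 1`), `coercive_of_blocks` (`P := 1`, no `C`) over
  `reindex_conj_one_eq_blockDiagonal` ∕ `reindex_conj_zero_eq_blockDiagonal`.
  This is the exact twin of `opNorm_le_of_blocks`; with it the spectral road's generic layer is in the tree by
  name and what remains is the MODELLING (B3) (the forms `d₁ᵀd₁`, the comb averages `Q_m`, the pin projection as
  block families over `blockEquiv`, and the per-sector soft-space transversality — see the docstring of
  `floor_of_blocks` for the intended blocks) + the nonlinear dressing (B4).
* §3 `Sxir_shift_ge_sharp`, `DeltaXir_shift_ge_sharp`: the SHARP edition of (B2),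
  `4n²·sin²(π∕(2n)) ≤ S_ξ(p′_μ + 2πk)` for `1 ≤ k ≤ n − 1`, `|p′_μ| ≤ π` (monotonicity of `sin` on `[0, π∕2]`
  in place of Jordan's inequality), i.e. `|k̂|² ≥ 4sin²(π∕2N)` on every aliased coset member — FL-26's closed-form
  floor (instr1 g14) is attained on the zone faces, so this constant is the right one for (B3).

HONEST: finite-dimensional linear algebra and one trigonometric inequality; NOTHING of Bałaban's analysis is
asserted or proved; `hFlat`, GAP♯∘ (v11.4), S2β, crux 20520 and `YM3TorusSU2` are NOT proved; no registered stub
is closed; rung R3 = SU(2) YM₃ on T³ at fixed lattice data — NOT d = 4, NOT infinite volume, NOT a mass gap, NOT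
Clay; the Yang–Mills mass gap is NOT proved.  Sorry-free, axioms standard.

References: [Balaban1984PropagatorsI] (1.29), (1.31) p.23, (1.83)–(1.84) p.31, Prop. 1.1 p.33 (the coset
decomposition and the fibrewise reading of block-translation-covariant operators); [Balaban1984PropagatorsII]
(1.33) (the constrained Poincaré-type floor this road serves).
-/

set_option autoImplicit false

open scoped BigOperators Matrix ComplexConjugate
open Finset Complex Matrix

namespace Summit.QuantumFields.YangMills.Theorems.FluctuationComparisonRegPrIntLS2BetaBlochFloorOfBlocks

open Literature.MathematicalPhysics.QuantumFieldTheory.Balaban1983to89.B4Strip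
open Literature.MathematicalPhysics.QuantumFieldTheory.Balaban1983to89.B5Prop11Leaves

/-! ## §1. Block-diagonal families: the quadratic form is the sum of the blocks' forms -/

section Blocks

variable {m' p' o : Type*} [Fintype m'] [Fintype o] [DecidableEq o]

/-- the action of a block-diagonal family (rectangular blocks `C_k : p′ × m′`) on a vector indexed by `m′ × o`:
its `(i, k)` entry is the `i`-th entry of `C_k` applied to the `k`-th block of the vector. [folklore] -/
theorem blockDiagonal_mulVec_apply (C : o → Matrix p' m' ℂ) (x : m' × o → ℂ) (i : p' × o) :
    (blockDiagonal C *ᵥ x) i = (C i.2 *ᵥ fun j => x (j, i.2)) i.1 := by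
  simp only [mulVec, dotProduct]
  rw [Fintype.sum_prod_type_right, Finset.sum_eq_single i.2]
  · simp [blockDiagonal_apply]
  · intro k _ hk
    simp [blockDiagonal_apply, Ne.symm hk]
  · simp

/-- a vector lies in the kernel of a block-diagonal family iff each of its blocks lies in the kernel of the
corresponding block. [folklore] -/
theorem blockDiagonal_mulVec_eq_zero_iff (C : o → Matrix p' m' ℂ) (x : m' × o → ℂ) :
    blockDiagonal C *ᵥ x = 0 ↔ ∀ k, (C k *ᵥ fun j => x (j, k)) = 0 := by
  constructor
  · intro h k
    funext i
    have hi := congrFun h (i, k)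
    rw [blockDiagonal_mulVec_apply] at hi
    simpa using hi
  · intro h
    funext i
    rw [blockDiagonal_mulVec_apply, h i.2]
    simp

/-- the quadratic form of a block-diagonal family is the sum over the blocks of the blocks' quadratic forms.
[folklore] -/
theorem star_dotProduct_blockDiagonal_mulVec (B : o → Matrix m' m' ℂ) (x : m' × o → ℂ) :
    star x ⬝ᵥ (blockDiagonal B *ᵥ x)
      = ∑ k, star (fun j => x (j, k)) ⬝ᵥ (B k *ᵥ fun j => x (j, k)) := by
  simp only [dotProduct]
  rw [Fintype.sum_prod_type_right]
  refine Finset.sum_congr rfl fun k _ => Finset.sum_congr rfl fun i _ => ?_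
  rw [blockDiagonal_mulVec_apply]
  simp

/-- ★ FLOOR OF A BLOCK-DIAGONAL FAMILY FROM BLOCKWISE FLOORS: if for every block `k` and every `y ∈ ker C_k`
one has `λ·re⟨y, P_k y⟩ ≤ re⟨y, A_k y⟩`, then for every `x ∈ ker (blockDiagonal C)`
`λ·re⟨x, (blockDiagonal P) x⟩ ≤ re⟨x, (blockDiagonal A) x⟩`. [folklore] -/
theorem floor_blockDiagonal_of_blocks (A P : o → Matrix m' m' ℂ) (C : o → Matrix p' m' ℂ) (lam : ℝ)
    (hblk : ∀ (k : o) (y : m' → ℂ), C k *ᵥ y = 0 →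
      lam * (star y ⬝ᵥ (P k *ᵥ y)).re ≤ (star y ⬝ᵥ (A k *ᵥ y)).re)
    (x : m' × o → ℂ) (hx : blockDiagonal C *ᵥ x = 0) :
    lam * (star x ⬝ᵥ (blockDiagonal P *ᵥ x)).re ≤ (star x ⬝ᵥ (blockDiagonal A *ᵥ x)).re := by
  rw [star_dotProduct_blockDiagonal_mulVec, star_dotProduct_blockDiagonal_mulVec, Complex.re_sum,
    Complex.re_sum, Finset.mul_sum]
  rw [blockDiagonal_mulVec_eq_zero_iff] at hx
  exact Finset.sum_le_sum fun k _ => hblk k _ (hx k)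

end Blocks

/-! ## §2. Transport under a unitary change of variables and a reindexing; the abstract Plancherel floor -/

section Transport

variable {m p m' p' o : Type*} [Fintype m] [DecidableEq m] [Fintype p] [Fintype m'] [Fintype o] [DecidableEq o]

/-- `(U′ C U^*)(U x) = U′ (C x)` for `U` unitary. [folklore] -/
theorem mulVec_conj_mulVec {U : Matrix m m ℂ} (hU : U ∈ Matrix.unitaryGroup m ℂ) (U' : Matrix p p ℂ)
    (C : Matrix p m ℂ) (x : m → ℂ) : (U' * C * star U) *ᵥ (U *ᵥ x) = U' *ᵥ (C *ᵥ x) := by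
  rw [mulVec_mulVec, mulVec_mulVec, Matrix.mul_assoc (U' * C), Matrix.mem_unitaryGroup_iff'.mp hU,
    Matrix.mul_one]

/-- a unitary preserves the Hermitian pairing: `⟨U x, U y⟩ = ⟨x, y⟩`. [folklore] -/
theorem star_mulVec_dotProduct_mulVec {U : Matrix m m ℂ} (hU : U ∈ Matrix.unitaryGroup m ℂ) (x y : m → ℂ) :
    star (U *ᵥ x) ⬝ᵥ (U *ᵥ y) = star x ⬝ᵥ y := by
  rw [star_mulVec, ← dotProduct_mulVec, mulVec_mulVec, ← star_eq_conjTranspose,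
    Matrix.mem_unitaryGroup_iff'.mp hU, one_mulVec]

/-- the quadratic form is invariant under unitary conjugation: `⟨U x, (U A U^*)(U x)⟩ = ⟨x, A x⟩`. [folklore] -/
theorem star_dotProduct_conj_mulVec {U : Matrix m m ℂ} (hU : U ∈ Matrix.unitaryGroup m ℂ) (A : Matrix m m ℂ)
    (x : m → ℂ) : star (U *ᵥ x) ⬝ᵥ ((U * A * star U) *ᵥ (U *ᵥ x)) = star x ⬝ᵥ (A *ᵥ x) := by
  rw [mulVec_conj_mulVec hU, star_mulVec_dotProduct_mulVec hU]

omit [DecidableEq m] [Fintype p] in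
/-- a (rectangularly) reindexed matrix acts on the reindexed vector as the reindexed image. [folklore] -/
theorem reindex_mulVec_comp_symm {n q : Type*} [Fintype n] (e : m ≃ n) (e' : p ≃ q)
    (M : Matrix p m ℂ) (x : m → ℂ) : (Matrix.reindex e' e M) *ᵥ (x ∘ e.symm) = (M *ᵥ x) ∘ e'.symm := by
  rw [reindex_apply, submatrix_mulVec_equiv]
  have hx : (x ∘ ⇑e.symm) ∘ ⇑e.symm.symm = x := by
    funext j
    simp
  rw [hx]

omit [DecidableEq m] in
/-- the Hermitian pairing is invariant under reindexing. [folklore] -/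
theorem star_comp_dotProduct_comp {n : Type*} [Fintype n] (e : m ≃ n) (x y : m → ℂ) :
    star (x ∘ e.symm) ⬝ᵥ (y ∘ e.symm) = star x ⬝ᵥ y := by
  simp only [dotProduct, Pi.star_apply, Function.comp_apply]
  exact e.symm.sum_comp (fun j => star (x j) * y j)

/-- ★★ THE ABSTRACT PLANCHEREL FLOOR (lower-bound twin of `B5Prop11Plancherel.opNorm_le_of_blocks`): let `U`
(on the variables) be unitary and `U′` (on the constraint's target) arbitrary, and suppose that along
reindexings `e : m ≃ m′ × o`, `e′ : p ≃ p′ × o` the conjugated forms `U A U^*`, `U P U^*` and the conjugated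
constraint `U′ C U^*` are block-diagonal with blocks `A_k`, `P_k`, `C_k` over an arbitrary finite block index `o`.
If every block obeys `λ·re⟨y, P_k y⟩ ≤ re⟨y, A_k y⟩` on `ker C_k`, then `λ·re⟨x, P x⟩ ≤ re⟨x, A x⟩` for every
`x ∈ ker C`.
INTENDED BLOCKS (UV3-NODE §53.10, the spectral road to `hFlat`'s linear core; nothing of this is asserted here):
`m` = fine 1-forms `Tor (N·M) × Fin 3`, `U` = the componentwise torus DFT `B5Prop11Plancherel.dftV`, `e` = the coset
reindexing `B5Prop11Plancherel.blockEquiv`, block index `o` = the Bloch sectors `Tor M`; `A_θ` = `d₁†d₁` on the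
`θ`-twisted 1-forms of ONE `N`-block; `C_θ` = the three `m`-fold comb functionals `q_μ(θ)` (rows `Tor M × Fin 3`, a
`3 × 3N³` block per sector; on the soft modes a convergent product of level symbols); `P_θ = 1 − Π_θ` with `Π_θ`
the orthogonal projector onto the sector's residual gauges `d₀{λ twisted, λ(r) = 0}` (so `dist_R(a)² = re⟨a, P a⟩`);
per-sector target `λ = 4∕N²` (registered exponent, lit `DeltaXir_shift_ge_four` on the aliased modes) or the sharp
`4sin²(π∕2N)` (§3 below). [folklore] -/
theorem floor_of_blocks {U : Matrix m m ℂ} (hU : U ∈ Matrix.unitaryGroup m ℂ) (U' : Matrix p p ℂ)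
    (e : m ≃ m' × o) (e' : p ≃ p' × o) (A P : Matrix m m ℂ) (C : Matrix p m ℂ)
    (Ab Pb : o → Matrix m' m' ℂ) (Cb : o → Matrix p' m' ℂ)
    (hA : Matrix.reindex e e (U * A * star U) = blockDiagonal Ab)
    (hP : Matrix.reindex e e (U * P * star U) = blockDiagonal Pb)
    (hC : Matrix.reindex e' e (U' * C * star U) = blockDiagonal Cb) (lam : ℝ)
    (hblk : ∀ (k : o) (y : m' → ℂ), Cb k *ᵥ y = 0 →
      lam * (star y ⬝ᵥ (Pb k *ᵥ y)).re ≤ (star y ⬝ᵥ (Ab k *ᵥ y)).re)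
    (x : m → ℂ) (hx : C *ᵥ x = 0) :
    lam * (star x ⬝ᵥ (P *ᵥ x)).re ≤ (star x ⬝ᵥ (A *ᵥ x)).re := by
  -- the block variables: `z := (U x) ∘ e⁻¹`
  set z : m' × o → ℂ := (U *ᵥ x) ∘ ⇑e.symm with hz
  have hformA : star x ⬝ᵥ (A *ᵥ x) = star z ⬝ᵥ (blockDiagonal Ab *ᵥ z) := by
    rw [← hA, hz, reindex_mulVec_comp_symm, star_comp_dotProduct_comp, star_dotProduct_conj_mulVec hU]
  have hformP : star x ⬝ᵥ (P *ᵥ x) = star z ⬝ᵥ (blockDiagonal Pb *ᵥ z) := by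
    rw [← hP, hz, reindex_mulVec_comp_symm, star_comp_dotProduct_comp, star_dotProduct_conj_mulVec hU]
  have hkerz : blockDiagonal Cb *ᵥ z = 0 := by
    rw [← hC, hz, reindex_mulVec_comp_symm, mulVec_conj_mulVec hU, hx, mulVec_zero]
    funext i
    simp
  rw [hformA, hformP]
  exact floor_blockDiagonal_of_blocks Ab Pb Cb lam hblk z hkerz

omit [Fintype m'] [Fintype o] in
/-- the identity form conjugates and reindexes to the identity blocks: `e (U·1·U^*) e⁻¹ = blockDiagonal 1`.
[folklore] -/
theorem reindex_conj_one_eq_blockDiagonal [DecidableEq m'] {U : Matrix m m ℂ} (hU : U ∈ Matrix.unitaryGroup m ℂ)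
    (e : m ≃ m' × o) :
    Matrix.reindex e e (U * (1 : Matrix m m ℂ) * star U) = blockDiagonal (fun _ : o => (1 : Matrix m' m' ℂ)) := by
  rw [Matrix.mul_one, Matrix.mem_unitaryGroup_iff.mp hU,
    show (fun _ : o => (1 : Matrix m' m' ℂ)) = 1 from rfl, blockDiagonal_one, reindex_apply,
    submatrix_one_equiv]

omit [DecidableEq m] [Fintype m'] [Fintype o] in
/-- the absent constraint conjugates and reindexes to the zero blocks. [folklore] -/
theorem reindex_conj_zero_eq_blockDiagonal (U' : Matrix p p ℂ) (U : Matrix m m ℂ) (e : m ≃ m' × o)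
    (e' : p ≃ p' × o) :
    Matrix.reindex e' e (U' * (0 : Matrix p m ℂ) * star U) = blockDiagonal (fun _ : o => (0 : Matrix p' m' ℂ)) := by
  rw [Matrix.mul_zero, Matrix.zero_mul, show (fun _ : o => (0 : Matrix p' m' ℂ)) = 0 from rfl,
    blockDiagonal_zero]
  ext i j
  simp

/-- (w4-a) the UNCONSTRAINED edition (no `C`; FL-26's all-gauge variants dock here): if `U A U^*` and `U P U^*`
are block-diagonal along some reindexing and every block obeys `λ·re⟨y, P_k y⟩ ≤ re⟨y, A_k y⟩` for ALL `y`,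
then `λ·re⟨x, P x⟩ ≤ re⟨x, A x⟩` for all `x`. [folklore] -/
theorem floor_of_blocks_unconstrained {U : Matrix m m ℂ} (hU : U ∈ Matrix.unitaryGroup m ℂ)
    (e : m ≃ m' × o) (A P : Matrix m m ℂ) (Ab Pb : o → Matrix m' m' ℂ)
    (hA : Matrix.reindex e e (U * A * star U) = blockDiagonal Ab)
    (hP : Matrix.reindex e e (U * P * star U) = blockDiagonal Pb) (lam : ℝ)
    (hblk : ∀ (k : o) (y : m' → ℂ), lam * (star y ⬝ᵥ (Pb k *ᵥ y)).re ≤ (star y ⬝ᵥ (Ab k *ᵥ y)).re)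
    (x : m → ℂ) : lam * (star x ⬝ᵥ (P *ᵥ x)).re ≤ (star x ⬝ᵥ (A *ᵥ x)).re :=
  floor_of_blocks hU (1 : Matrix m m ℂ) e e A P (0 : Matrix m m ℂ) Ab Pb (fun _ => 0) hA hP
    (reindex_conj_zero_eq_blockDiagonal 1 U e e) lam (fun k y _ => hblk k y) x (by simp)

/-- (w4-b) the PLAIN-COERCIVITY edition on a kernel (`P := 1`, `‖x‖² = re⟨x, x⟩`): if `U A U^*` and `U′ C U^*`
are block-diagonal along some reindexings and every block is coercive on `ker C_k`, `λ·‖y‖² ≤ re⟨y, A_k y⟩`,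
then `λ·‖x‖² ≤ re⟨x, A x⟩` on `ker C`. [folklore] -/
theorem coercive_of_blocks_on_ker [DecidableEq m'] {U : Matrix m m ℂ} (hU : U ∈ Matrix.unitaryGroup m ℂ)
    (U' : Matrix p p ℂ) (e : m ≃ m' × o) (e' : p ≃ p' × o) (A : Matrix m m ℂ) (C : Matrix p m ℂ)
    (Ab : o → Matrix m' m' ℂ) (Cb : o → Matrix p' m' ℂ)
    (hA : Matrix.reindex e e (U * A * star U) = blockDiagonal Ab)
    (hC : Matrix.reindex e' e (U' * C * star U) = blockDiagonal Cb) (lam : ℝ)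
    (hblk : ∀ (k : o) (y : m' → ℂ), Cb k *ᵥ y = 0 → lam * (star y ⬝ᵥ y).re ≤ (star y ⬝ᵥ (Ab k *ᵥ y)).re)
    (x : m → ℂ) (hx : C *ᵥ x = 0) : lam * (star x ⬝ᵥ x).re ≤ (star x ⬝ᵥ (A *ᵥ x)).re := by
  have h := floor_of_blocks hU U' e e' A 1 C Ab (fun _ => 1) Cb hA (reindex_conj_one_eq_blockDiagonal hU e) hC
    lam (fun k y hy => by simpa using hblk k y hy) x hx
  simpa using h

/-- (w4-c) the unconstrained plain-coercivity edition: if `U A U^*` is block-diagonal along some reindexing with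
every block coercive, `λ·‖y‖² ≤ re⟨y, A_k y⟩`, then `λ·‖x‖² ≤ re⟨x, A x⟩`. [folklore] -/
theorem coercive_of_blocks [DecidableEq m'] {U : Matrix m m ℂ} (hU : U ∈ Matrix.unitaryGroup m ℂ)
    (e : m ≃ m' × o)
    (A : Matrix m m ℂ) (Ab : o → Matrix m' m' ℂ) (hA : Matrix.reindex e e (U * A * star U) = blockDiagonal Ab)
    (lam : ℝ) (hblk : ∀ (k : o) (y : m' → ℂ), lam * (star y ⬝ᵥ y).re ≤ (star y ⬝ᵥ (Ab k *ᵥ y)).re)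
    (x : m → ℂ) : lam * (star x ⬝ᵥ x).re ≤ (star x ⬝ᵥ (A *ᵥ x)).re :=
  coercive_of_blocks_on_ker hU (1 : Matrix m m ℂ) e e A (0 : Matrix m m ℂ) Ab (fun _ => 0) hA
    (reindex_conj_zero_eq_blockDiagonal 1 U e e) lam (fun k y _ => hblk k y) x (by simp)

end Transport

/-! ## §3. The SHARP aliased-mode symbol bound -/

section Aliased

variable {d : ℕ}

/-- SHARP E1: `|∂_μ(p′ + l)|² ≥ 4n²·sin²(π∕(2n))` whenever `l_μ = 2πk`, `1 ≤ k ≤ n − 1`, `|p′_μ| ≤ π`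
(then `θ = (p′_μ + 2πk)∕2n ∈ [π∕2n, π − π∕2n]`, so `sin θ ≥ sin(π∕2n)` by monotonicity of `sin` on `[0, π∕2]`).
In block units this is `|k̂|² ≥ 4sin²(π∕2N)` for every aliased mode `k = θ + 2πj∕N`, `j ≠ 0` — the closed-form
FL-26 floor, attained on the zone faces; the Jordan edition `≥ 4` is lit `B5Prop11Leaves.Sxir_shift_ge_four`.
[folklore] -/
theorem Sxir_shift_ge_sharp (n k : ℕ) (hk1 : 1 ≤ k) (hk2 : k + 1 ≤ n) (x : ℝ) (hx : |x| ≤ Real.pi) :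
    4 * (n : ℝ) ^ 2 * Real.sin (Real.pi / (2 * n)) ^ 2 ≤ Sxir n (x + 2 * Real.pi * k) := by
  rw [Sxir_eq]
  have hpi := Real.pi_pos
  have hk1' : (1 : ℝ) ≤ k := by exact_mod_cast hk1
  have hk2' : (k : ℝ) + 1 ≤ n := by exact_mod_cast hk2
  have hn0 : (0 : ℝ) < n := by linarith
  obtain ⟨hx1, hx2⟩ := abs_le.mp hx
  set θ := (x + 2 * Real.pi * k) / (2 * n) with hθ
  have hθ1 : Real.pi / (2 * n) ≤ θ := by
    rw [hθ, div_le_div_iff_of_pos_right (by positivity)]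
    nlinarith
  have hθ2 : θ ≤ Real.pi - Real.pi / (2 * n) := by
    have e1 : θ + Real.pi / (2 * n) = (x + 2 * Real.pi * k + Real.pi) / (2 * n) := by rw [hθ]; ring
    have e2 : (x + 2 * Real.pi * k + Real.pi) / (2 * n) ≤ Real.pi := by
      rw [div_le_iff₀ (by positivity)]; nlinarith
    linarith
  have hδ0 : 0 ≤ Real.pi / (2 * n) := by positivity
  have hδ1 : Real.pi / (2 * n) ≤ Real.pi / 2 := by
    rw [div_le_div_iff_of_pos_left hpi (by positivity) (by norm_num)]
    linarith
  have key : ∀ ψ : ℝ, Real.pi / (2 * n) ≤ ψ → ψ ≤ Real.pi / 2 →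
      Real.sin (Real.pi / (2 * n)) ≤ Real.sin ψ := by
    intro ψ hψ1 hψ2
    exact Real.sin_le_sin_of_le_of_le_pi_div_two (by linarith) hψ2 hψ1
  have hsin : Real.sin (Real.pi / (2 * n)) ≤ Real.sin θ := by
    rcases le_total θ (Real.pi / 2) with h | h
    · exact key θ hθ1 h
    · rw [← Real.sin_pi_sub θ]
      exact key _ (by linarith) (by linarith)
  have h0 : 0 ≤ Real.sin (Real.pi / (2 * n)) :=
    Real.sin_nonneg_of_nonneg_of_le_pi hδ0 (by linarith)
  have hsq : Real.sin (Real.pi / (2 * n)) ^ 2 ≤ Real.sin θ ^ 2 := by gcongr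
  have h4 : (0 : ℝ) ≤ 4 * (n : ℝ) ^ 2 := by positivity
  exact mul_le_mul_of_nonneg_left hsq h4

/-- SHARP E1 summed: `Δ(p′ + l) ≥ 4n²·sin²(π∕(2n))` for `l ≠ 0` on the Brillouin zone. [folklore] -/
theorem DeltaXir_shift_ge_sharp (n : ℕ) [NeZero n] (k : Fin d → Fin n) (hk : k ≠ fun _ => 0)
    (s : Fin d → ℝ) (hs : ∀ μ, |s μ| ≤ Real.pi) :
    4 * (n : ℝ) ^ 2 * Real.sin (Real.pi / (2 * n)) ^ 2 ≤ DeltaXir n 0 (shiftr n k s) := by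
  obtain ⟨μ, hμ⟩ : ∃ μ, k μ ≠ 0 := Function.ne_iff.mp hk
  have hk1 : 1 ≤ (k μ : ℕ) := Nat.one_le_iff_ne_zero.mpr (fun h => hμ (Fin.ext h))
  have hk2 : (k μ : ℕ) + 1 ≤ n := (k μ).isLt
  have h1 := Sxir_shift_ge_sharp n (k μ : ℕ) hk1 hk2 (s μ) (hs μ)
  unfold DeltaXir shiftr
  simp only [add_zero]
  have h2 : Sxir n (s μ + 2 * Real.pi * ((k μ : ℕ) : ℝ)) ≤ ∑ ν, Sxir n (s ν + 2 * Real.pi * ((k ν : ℕ) : ℝ)) :=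
    Finset.single_le_sum (f := fun ν => Sxir n (s ν + 2 * Real.pi * ((k ν : ℕ) : ℝ)))
      (fun ν _ => Sxir_nonneg n _) (Finset.mem_univ μ)
  linarith

/-- the sharp floor dominates the Jordan floor: `4 ≤ 4n²·sin²(π∕(2n))` for `n ≥ 1` (so `Sxir_shift_ge_sharp`
refines lit `Sxir_shift_ge_four`). [folklore] -/
theorem four_le_sharpFloor (n : ℕ) (hn : 1 ≤ n) : 4 ≤ 4 * (n : ℝ) ^ 2 * Real.sin (Real.pi / (2 * n)) ^ 2 := by
  have hpi := Real.pi_pos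
  have hn0 : (0 : ℝ) < n := by exact_mod_cast hn
  have hψ0 : 0 ≤ Real.pi / (2 * n) := by positivity
  have hψ1 : Real.pi / (2 * n) ≤ Real.pi / 2 := by
    rw [div_le_div_iff_of_pos_left hpi (by positivity) (by norm_num)]
    have : (1 : ℝ) ≤ n := by exact_mod_cast hn
    linarith
  have hj := Real.mul_le_sin hψ0 hψ1
  have h1 : 1 / (n : ℝ) ≤ Real.sin (Real.pi / (2 * n)) := by
    calc 1 / (n : ℝ) = 2 / Real.pi * (Real.pi / (2 * n)) := by field_simp
      _ ≤ Real.sin (Real.pi / (2 * n)) := hj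
  have h0 : 0 ≤ 1 / (n : ℝ) := by positivity
  have hsq : (1 / (n : ℝ)) ^ 2 ≤ Real.sin (Real.pi / (2 * n)) ^ 2 := by gcongr
  calc (4 : ℝ) = 4 * (n : ℝ) ^ 2 * (1 / (n : ℝ)) ^ 2 := by field_simp
    _ ≤ 4 * (n : ℝ) ^ 2 * Real.sin (Real.pi / (2 * n)) ^ 2 := by gcongr

end Aliased

end Summit.QuantumFields.YangMills.Theorems.FluctuationComparisonRegPrIntLS2BetaBlochFloorOfBlocks
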